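import Literature.AlgebraicGeometry.Motives.MixedHodgeStructureSplitOverQGraded
import Literature.AlgebraicGeometry.Motives.MixedHodgeStructureSplitOverQExtensions
import Literature.AlgebraicGeometry.Motives.MixedHodgeStructureGrWConservative
import HarnessLib

/-!
# Morphisms of `ℚ`-split mixed Hodge structures; `Gr^W` is fully faithful on `ℚ`-split MHS

Green–Griffiths–Kerr, *Mumford–Tate groups and domains*, §I.C (I.C.7)–(I.C.8) and footnote 3: the `ℚ`-split
MHS are the "general Hodge structures" `V^split = ⊕ᵢ Gr^W_i V`, and the passage `V ↦ V^split` (`ξ`) is defined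
over `ℚ`. Cattani–El Zein–Griffiths–Lê, Prop. 3.2.19 Remark (ii) (morphisms are compatible with `⊕ I^{p,q}`),
Thm. 3.2.18 (bijective morphisms are isomorphisms), Def. 3.2.15 (`Gr^W_n`). Deligne, *Théorie de Hodge II*,
Thm. 2.3.5 (iii)–(iv) (strictness; `Gr^W_n` exact).

For `ℚ`-split `H`, `H'` (`IsSplitOverQ`; weight pieces `U_n = h.weightForm n`, `⊕ U_n = V`,
`U_n ⥲ Gr^W_n H`, `Motives/MixedHodgeStructureSplitOverQGraded`):

* §1 **morphisms respect the weight pieces**: `f(U_n) ⊆ U'_n` (`IsSplitOverQ.map_weightForm_le`), the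
  restrictions `f_n : U_n → U'_n` (`weightPieceMap`) and their compatibility with `Gr^W_n(f)`
  (`weightPieceGrHom_comp_weightPieceMap`).
* §2 the **canonical complement** `⊕_{m ≠ n} U_m` of `U_n` (`weightCompl`, a sub-MHS) and the **projection
  morphism** `π_n : H → U_n` (`weightProj`; identity on `U_n`, zero on `U_m`, `m ≠ n`).
* §3 **naturality**: `π'_n ∘ f = f_n ∘ π_n` (`weightProj_comp`).
* §4 **`Gr^W` is fully faithful on `ℚ`-split MHS**: every family of morphisms `g_n : Gr^W_n H → Gr^W_n H'` is
  `(Gr^W_n f)_n` for a unique morphism `f : H → H'` (`IsSplitOverQ.exists_hom_grMap_eq`, `…_unique`).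

All statements proved; definitions with bodies; no named facts, no instances.

## References

* [GreenGriffithsKerr2012] M. Green, P. Griffiths, M. Kerr, Mumford–Tate groups and domains (2012), §I.C
  (I.C.7)–(I.C.8), footnote 3.
* [CattaniElZeinGriffithsLe2014] E. Cattani et al. (eds.), Hodge Theory (2014), Thm. 3.2.18, Def. 3.2.15,
  Prop. 3.2.19 Remark (ii).
* [DeligneHodgeII1971] P. Deligne, Théorie de Hodge II, Thm. 2.3.5 (iii)–(iv).
-/

noncomputable section

open scoped TensorProduct

namespace Literature.AlgebraicGeometry.Motives

namespace MixedHodgeStructure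

open Literature.LinearAlgebra.BaseChange (baseChange_map baseChange_iSup)

universe u v

variable {V : Type u} [AddCommGroup V] [Module ℚ V]
variable {V' : Type v} [AddCommGroup V'] [Module ℚ V']
variable {H : MixedHodgeStructure V} {H' : MixedHodgeStructure V'}

namespace IsSplitOverQ

/-! ### §1 Morphisms respect the weight pieces -/

/-- **`f(U_n) ⊆ U'_n`**: a morphism of `ℚ`-split MHS maps weight pieces into weight pieces (`f_ℂ(E_n) ⊆ E'_n`
and the `U_n` are the `ℚ`-forms of the `E_n`). [cite: CattaniElZeinGriffithsLe2014, Prop. 3.2.19, Remark (ii)] -/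
theorem map_weightForm_le (h : H.IsSplitOverQ) (h' : H'.IsSplitOverQ) (f : Hom H H') (n : ℤ) :
    (h.weightForm n).map f.toLinearMap ≤ h'.weightForm n :=
  le_of_baseChange_le (by
    rw [baseChange_map ℂ, h.baseChange_weightForm, h'.baseChange_weightForm]
    exact f.map_deligneE_le n)

/-- Elementwise form of `map_weightForm_le`. [cite: CattaniElZeinGriffithsLe2014, Prop. 3.2.19, Remark (ii)] -/
theorem apply_mem_weightForm (h : H.IsSplitOverQ) (h' : H'.IsSplitOverQ) (f : Hom H H') {n : ℤ} {x : V}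
    (hx : x ∈ h.weightForm n) : f.toLinearMap x ∈ h'.weightForm n :=
  h.map_weightForm_le h' f n ⟨x, hx, rfl⟩

/-- **The restriction `f_n : U_n → U'_n`** of a morphism to the weight pieces. [cite: GreenGriffithsKerr2012, §I.C (I.C.8)] -/
def weightPieceMap (h : H.IsSplitOverQ) (h' : H'.IsSplitOverQ) (f : Hom H H') (n : ℤ) :
    Hom (h.weightPiece n).toMixedHodgeStructure (h'.weightPiece n).toMixedHodgeStructure :=
  (h.weightPiece n).restrictHom (h'.weightPiece n) f fun _ hx => h.apply_mem_weightForm h' f hx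

/-- `f_n` on underlying vectors is `f` (by `rfl`). [cite: GreenGriffithsKerr2012, §I.C (I.C.8)] -/
@[simp]
theorem coe_weightPieceMap_apply (h : H.IsSplitOverQ) (h' : H'.IsSplitOverQ) (f : Hom H H') (n : ℤ)
    (u : ↥(h.weightForm n)) : ((h.weightPieceMap h' f n).toLinearMap u : V') = f.toLinearMap u := rfl

/-- **Compatibility with `Gr^W_n(f)`**: under `U_n ⥲ Gr^W_n H` and `U'_n ⥲ Gr^W_n H'` the restriction `f_n`
is `Gr^W_n(f)`. [cite: CattaniElZeinGriffithsLe2014, Def. 3.2.15] -/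
theorem weightPieceGrHom_comp_weightPieceMap (h : H.IsSplitOverQ) (h' : H'.IsSplitOverQ) (f : Hom H H') (n : ℤ) :
    (h'.weightPieceGrHom n).toLinearMap ∘ₗ (h.weightPieceMap h' f n).toLinearMap =
      f.grMap n ∘ₗ (h.weightPieceGrHom n).toLinearMap :=
  LinearMap.ext fun _ => rfl

/-! ### §2 The canonical complement `⊕_{m ≠ n} U_m` and the projection `π_n : H → U_n` -/

/-- `(⊕_{m ≠ n} U_m)_ℂ = ⊕_{m ≠ n} E_m`. [cite: GreenGriffithsKerr2012, §I.C (I.C.7)] -/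
theorem baseChange_biSup_weightForm_ne (h : H.IsSplitOverQ) (n : ℤ) :
    (⨆ (m : ℤ) (_ : m ≠ n), h.weightForm m).baseChange ℂ = ⨆ m ∈ ({n}ᶜ : Set ℤ), H.deligneE m := by
  rw [baseChange_iSup ℂ]
  refine iSup_congr fun m => ?_
  rw [baseChange_iSup ℂ, h.baseChange_weightForm]
  exact le_antisymm (iSup_le fun hm => le_iSup_of_le (show m ∈ ({n}ᶜ : Set ℤ) from hm) le_rfl)
    (iSup_le fun hm => le_iSup_of_le (show m ≠ n from hm) le_rfl)

/-- **The canonical complement `⊕_{m ≠ n} U_m` of `U_n`**, a sub-MHS. [cite: GreenGriffithsKerr2012, §I.C (I.C.7)] -/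
def weightCompl (h : H.IsSplitOverQ) (n : ℤ) : SubMixedHodgeStructure H :=
  SubMixedHodgeStructure.ofCompatible H (⨆ (m : ℤ) (_ : m ≠ n), h.weightForm m) (by
    rw [h.baseChange_biSup_weightForm_ne n]
    exact H.biSup_deligneE_le_iSup_inf _)

/-- The underlying subspace of `weightCompl n` (by `rfl`). [cite: GreenGriffithsKerr2012, §I.C (I.C.7)] -/
@[simp]
theorem weightCompl_toSubmodule (h : H.IsSplitOverQ) (n : ℤ) :
    (h.weightCompl n).toSubmodule = ⨆ (m : ℤ) (_ : m ≠ n), h.weightForm m := rfl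

/-- **`U_n ⊕ (⊕_{m ≠ n} U_m) = V`.** [cite: GreenGriffithsKerr2012, §I.C (I.C.7)] -/
theorem isCompl_weightCompl_weightForm (h : H.IsSplitOverQ) (n : ℤ) :
    IsCompl (h.weightCompl n).toSubmodule (h.weightPiece n).toSubmodule := by
  rw [weightCompl_toSubmodule, weightPiece_toSubmodule]
  refine IsCompl.of_eq ?_ ?_
  · rw [inf_comm]
    exact (h.iSupIndep_weightForm n).eq_bot
  · rw [sup_comm, ← iSup_split_single, h.iSup_weightForm_eq_top]

/-- **The projection `π_n : H → U_n` along `⊕_{m ≠ n} U_m`, a morphism of MHS.** [cite: GreenGriffithsKerr2012, §I.C (I.C.8)] -/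
def weightProj (h : H.IsSplitOverQ) (n : ℤ) : Hom H (h.weightPiece n).toMixedHodgeStructure :=
  SubMixedHodgeStructure.projOfIsCompl (h.weightCompl n) (h.weightPiece n) (h.isCompl_weightCompl_weightForm n)

/-- `π_n` is the identity on `U_n`. [cite: GreenGriffithsKerr2012, §I.C (I.C.8)] -/
@[simp]
theorem weightProj_apply_coe (h : H.IsSplitOverQ) (n : ℤ) (u : ↥(h.weightForm n)) : (h.weightProj n).toLinearMap u = u :=
  SubMixedHodgeStructure.projOfIsCompl_apply_of_mem_right (h.weightCompl n) (h.weightPiece n)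
    (h.isCompl_weightCompl_weightForm n) u

/-- `π_n(x) = x` for `x ∈ U_n`. [cite: GreenGriffithsKerr2012, §I.C (I.C.8)] -/
theorem weightProj_apply_of_mem (h : H.IsSplitOverQ) (n : ℤ) {x : V} (hx : x ∈ h.weightForm n) :
    (h.weightProj n).toLinearMap x = ⟨x, hx⟩ :=
  h.weightProj_apply_coe n ⟨x, hx⟩

/-- `π_n` kills `⊕_{m ≠ n} U_m`. [cite: GreenGriffithsKerr2012, §I.C (I.C.8)] -/
theorem weightProj_apply_of_mem_weightCompl (h : H.IsSplitOverQ) (n : ℤ) {x : V}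
    (hx : x ∈ (h.weightCompl n).toSubmodule) : (h.weightProj n).toLinearMap x = 0 :=
  SubMixedHodgeStructure.projOfIsCompl_apply_of_mem_left (h.weightCompl n) (h.weightPiece n)
    (h.isCompl_weightCompl_weightForm n) hx

/-- `π_n(x) = 0` for `x ∈ U_m`, `m ≠ n`. [cite: GreenGriffithsKerr2012, §I.C (I.C.8)] -/
theorem weightProj_apply_of_mem_ne (h : H.IsSplitOverQ) {n m : ℤ} (hmn : m ≠ n) {x : V} (hx : x ∈ h.weightForm m) :
    (h.weightProj n).toLinearMap x = 0 :=
  h.weightProj_apply_of_mem_weightCompl n (Submodule.mem_iSup_of_mem m (Submodule.mem_iSup_of_mem hmn hx))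

/-- `x - π_n(x) ∈ ⊕_{m ≠ n} U_m`. [cite: GreenGriffithsKerr2012, §I.C (I.C.8)] -/
theorem sub_weightProj_mem (h : H.IsSplitOverQ) (n : ℤ) (x : V) :
    x - ((h.weightProj n).toLinearMap x : V) ∈ (h.weightCompl n).toSubmodule := by
  have hx : x ∈ (h.weightCompl n).toSubmodule ⊔ (h.weightPiece n).toSubmodule := by
    rw [(h.isCompl_weightCompl_weightForm n).sup_eq_top]; exact Submodule.mem_top
  obtain ⟨c, hc, u, hu, rfl⟩ := Submodule.mem_sup.1 hx
  rw [map_add, h.weightProj_apply_of_mem_weightCompl n hc, zero_add, h.weightProj_apply_of_mem n hu,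
    add_sub_cancel_right]
  exact hc

/-- **`x = Σ_{n ∈ s} π_n(x)`** for a finite set `s` of weights carrying the non-zero pieces.
[cite: GreenGriffithsKerr2012, §I.C (I.C.7)] -/
theorem sum_weightProj (h : H.IsSplitOverQ) {s : Finset ℤ} (hs : ∀ n, n ∉ s → h.weightForm n = ⊥) (x : V) :
    ∑ n ∈ s, ((h.weightProj n).toLinearMap x : V) = x := by
  have hx : x ∈ ⨆ n ∈ s, h.weightForm n := by rw [h.biSup_weightForm_eq_top hs]; exact Submodule.mem_top
  obtain ⟨μ, rfl⟩ := (Submodule.mem_iSup_finset_iff_exists_sum _ _).1 hx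
  refine Finset.sum_congr rfl fun n hn => ?_
  rw [map_sum, Submodule.coe_sum, Finset.sum_eq_single n (fun m hm hmn => ?_) (fun h' => absurd hn h')]
  · rw [h.weightProj_apply_coe]
  · rw [h.weightProj_apply_of_mem_ne hmn (μ m).2]
    rfl

/-! ### §3 Naturality of the projections -/

/-- `f` maps `⊕_{m ≠ n} U_m` into `⊕_{m ≠ n} U'_m`. [cite: CattaniElZeinGriffithsLe2014, Prop. 3.2.19, Remark (ii)] -/
theorem map_weightCompl_le (h : H.IsSplitOverQ) (h' : H'.IsSplitOverQ) (f : Hom H H') (n : ℤ) :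
    (h.weightCompl n).toSubmodule.map f.toLinearMap ≤ (h'.weightCompl n).toSubmodule := by
  rw [weightCompl_toSubmodule, weightCompl_toSubmodule, Submodule.map_iSup]
  refine iSup_mono fun m => ?_
  rw [Submodule.map_iSup]
  exact iSup_mono fun _ => h.map_weightForm_le h' f m

/-- **Naturality `π'_n ∘ f = f_n ∘ π_n`.** [cite: GreenGriffithsKerr2012, §I.C (I.C.8)] -/
theorem weightProj_comp (h : H.IsSplitOverQ) (h' : H'.IsSplitOverQ) (f : Hom H H') (n : ℤ) :
    (h'.weightProj n).comp f = (h.weightPieceMap h' f n).comp (h.weightProj n) := by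
  refine Hom.ext (LinearMap.ext fun x => ?_)
  rw [Hom.comp_toLinearMap, LinearMap.comp_apply, Hom.comp_toLinearMap, LinearMap.comp_apply]
  have hsplit : x = (x - ((h.weightProj n).toLinearMap x : V)) + ((h.weightProj n).toLinearMap x : V) := by abel
  rw [hsplit, map_add, map_add, h'.weightProj_apply_of_mem_weightCompl n
    (h.map_weightCompl_le h' f n ⟨_, h.sub_weightProj_mem n x, rfl⟩), zero_add,
    h'.weightProj_apply_of_mem n (h.apply_mem_weightForm h' f ((h.weightProj n).toLinearMap x).2)]
  rw [← hsplit]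
  rfl

/-! ### §4 `Gr^W` is fully faithful on `ℚ`-split mixed Hodge structures -/

/-- `π_n` is determined on `U_n`-vectors of `⊕_{m ∈ s} U_m`: `(⊕ U)⁻¹(u) = single_n u` for `u ∈ U_n`.
[cite: GreenGriffithsKerr2012, §I.C (I.C.7)] -/
theorem piWeightPieceHom_single (h : H.IsSplitOverQ) (s : Finset ℤ) (n : ↥s) (u : ↥(h.weightForm n)) :
    (h.piWeightPieceHom s).toLinearMap (Pi.single n u) = (u : V) := by
  rw [h.piWeightPieceHom_toLinearMap_apply, Finset.sum_eq_single n
    (fun m _ hm => by rw [Pi.single_eq_of_ne hm]; rfl) (fun h' => absurd (Finset.mem_univ _) h'), Pi.single_eq_same]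

/-- **Fullness of `Gr^W`**: for `ℚ`-split `H`, `H'`, every family of morphisms `g_n : Gr^W_n H → Gr^W_n H'` of
(mixed) Hodge structures is induced by a morphism `f : H → H'`: `Gr^W_n(f) = g_n` for all `n`
(`f = ⊕_n (U'_n ≅ Gr_n H')⁻¹ ∘ g_n ∘ (U_n ≅ Gr_n H)` transported along `⊕ U_n ≅ H`).
[cite: GreenGriffithsKerr2012, §I.C (I.C.7)–(I.C.8), footnote 3] -/
theorem exists_hom_grMap_eq (h : H.IsSplitOverQ) (h' : H'.IsSplitOverQ)
    (g : ∀ n : ℤ, Hom (H.gr n).toMixedHodgeStructure (H'.gr n).toMixedHodgeStructure) :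
    ∃ f : Hom H H', ∀ n, f.grMap n = (g n).toLinearMap := by
  obtain ⟨s₁, hs₁⟩ := h.exists_finset_weightForm_eq_bot
  obtain ⟨s₂, hs₂⟩ := h'.exists_finset_weightForm_eq_bot
  let s := s₁ ∪ s₂
  have hs : ∀ n, n ∉ s → h.weightForm n = ⊥ := fun n hn => hs₁ n fun h1 => hn (Finset.mem_union_left _ h1)
  have hs' : ∀ n, n ∉ s → h'.weightForm n = ⊥ := fun n hn => hs₂ n fun h2 => hn (Finset.mem_union_right _ h2)
  -- the pieces `φ_n = e'_n⁻¹ ∘ g_n ∘ e_n : U_n → U'_n`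
  let φ : ∀ n : ↥s, Hom (h.weightPiece n).toMixedHodgeStructure (h'.weightPiece n).toMixedHodgeStructure := fun n =>
    ((h'.weightPieceGrHom n).inverse (h'.weightPieceGrHom_bijective n)).comp ((g n).comp (h.weightPieceGrHom n))
  have hφ : ∀ (n : ↥s) (u : ↥(h.weightForm n)),
      (h'.weightPieceGrHom n).toLinearMap ((φ n).toLinearMap u) = (g n).toLinearMap ((h.weightPieceGrHom n).toLinearMap u) := by
    intro n u
    change ((h'.weightPieceGrHom n).comp ((h'.weightPieceGrHom n).inverse (h'.weightPieceGrHom_bijective n))).toLinearMap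
      ((g n).toLinearMap ((h.weightPieceGrHom n).toLinearMap u)) = _
    rw [Hom.comp_inverse]
    rfl
  let ι := (h.piWeightPieceHom s).inverse (h.piWeightPieceHom_bijective hs)
  refine ⟨(h'.piWeightPieceHom s).comp ((Hom.piMap φ).comp ι), fun n => ?_⟩
  -- check on `Gr^W_n`: classes of `u ∈ U_n` generate (`W_n = W_{n-1} ⊕ U_n`)
  refine LinearMap.ext fun y => ?_
  induction y using Submodule.Quotient.induction_on with
  | _ w =>
    have hw : (w : V) ∈ H.W (n - 1) ⊔ h.weightForm n := by rw [h.W_pred_sup_weightForm n]; exact w.2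
    obtain ⟨a, ha, u, hu, hau⟩ := Submodule.mem_sup.1 hw
    have hcl : (Submodule.Quotient.mk w : grW H.W n) = Submodule.Quotient.mk ⟨u, h.weightForm_le_W n hu⟩ := by
      refine (Submodule.Quotient.eq _).2 ?_
      change ((w : V) - u) ∈ H.W (n - 1)
      rw [← hau, add_sub_cancel_right]
      exact ha
    rw [hcl, Hom.grMap_mk]
    by_cases hn : n ∈ s
    · -- `f u = φ_n u`
      have hιu : ι.toLinearMap u = Pi.single (⟨n, hn⟩ : ↥s) ⟨u, hu⟩ := by
        apply (h.piWeightPieceHom_bijective hs).1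
        change ((h.piWeightPieceHom s).comp ι).toLinearMap u = _
        rw [Hom.comp_inverse, h.piWeightPieceHom_single]
        rfl
      have hfu : ((h'.piWeightPieceHom s).comp ((Hom.piMap φ).comp ι)).toLinearMap u =
          ((φ ⟨n, hn⟩).toLinearMap ⟨u, hu⟩ : V') := by
        rw [Hom.comp_toLinearMap, LinearMap.comp_apply, Hom.comp_toLinearMap, LinearMap.comp_apply, hιu,
          show (Hom.piMap φ).toLinearMap (Pi.single (⟨n, hn⟩ : ↥s) ⟨u, hu⟩) =
            Pi.single (⟨n, hn⟩ : ↥s) ((φ ⟨n, hn⟩).toLinearMap ⟨u, hu⟩) from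
            funext fun m => by
              rw [Hom.piMap_toLinearMap_apply]
              exact Pi.apply_single (fun (m : ↥s) (x : ↥(h.weightForm (m : ℤ))) =>
                  ((φ m).toLinearMap x : ↥(h'.weightForm (m : ℤ)))) (fun m => map_zero _) ⟨n, hn⟩ ⟨u, hu⟩ m,
          h'.piWeightPieceHom_single]
      have hcl' : (Submodule.Quotient.mk (((h'.piWeightPieceHom s).comp ((Hom.piMap φ).comp ι)).restrictW n
          ⟨u, h.weightForm_le_W n hu⟩) : grW H'.W n) =
          (h'.weightPieceGrHom n).toLinearMap ((φ ⟨n, hn⟩).toLinearMap ⟨u, hu⟩) := by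
        rw [weightPieceGrHom_toLinearMap_apply]
        exact congrArg Submodule.Quotient.mk (Subtype.ext hfu)
      rw [hcl']
      exact hφ ⟨n, hn⟩ ⟨u, hu⟩
    · -- `n ∉ s`: `U_n = 0`, so `u = 0` and both sides vanish
      have hu0 : u = 0 := by
        have := hs n hn ▸ hu
        exact (Submodule.mem_bot ℚ).1 this
      subst hu0
      rw [show (⟨(0 : V), h.weightForm_le_W n hu⟩ : ↥(H.W n)) = 0 from rfl, Submodule.Quotient.mk_zero, map_zero,
        map_zero, Submodule.Quotient.mk_zero]

/-- **Faithfulness of `Gr^W`** (holds for all MHS): a morphism is determined by the `Gr^W_n(f)`.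
[cite: DeligneHodgeII1971, Thm. 2.3.5 (iii)–(iv)] -/
theorem hom_grMap_eq_unique (f f' : Hom H H') (hff' : ∀ n, f.grMap n = f'.grMap n) : f = f' :=
  (Hom.eq_iff_forall_grMap_eq f f').2 hff'

end IsSplitOverQ

end MixedHodgeStructure

end Literature.AlgebraicGeometry.Motives
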